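import Mathlib.NumberTheory.LegendreSymbol.QuadraticReciprocity
import Mathlib.GroupTheory.OrderOfElement
import Mathlib.FieldTheory.Finite.Basic
import HarnessLib

/-!
# Route `AdditiveKolyvaginRoad`, crux `ManinFrameResidueProperR` (stmt-BirchSwinnertonDyer-20709), line
# `tame-twist`, stub S57 (`p ∈ {5, 7}`): the multiplicative order of `p` modulo the auxiliary prime `d′`
# is prime to `p − 1` — `--supports`, helper

Cell `pub/bsd-wall`, seat `bsd-wall-manin-p1` g4. Pure arithmetic. For the `p ∈ {5, 7}` extension of the
tame-twist lever (g3, `…RTameTwistFull*`) the Kosters–Pannekoek receptacle over the completion of `ℚ(ζ_{d′})`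
at a prime above `p` (unramified of degree `n = ord_{d′}(p)`) is exception-free as soon as `gcd(n, p − 1) = 1`
and `E(ℚ_p)[p] = 0` (Literature fact `kato_neron_isIntegral_twistedSymbolSum_of_additive_five_le`). This file
proves the arithmetic input: if `d′ ≡ 3 (mod 4)` is a prime `≠ 2, p`, no odd prime `r ∣ p − 1` divides
`d′ − 1`, and `p` is a square modulo `d′`, then `gcd(ord_{d′}(p), p − 1) = 1` (`p^{(d′−1)/2} = 1` with
`(d′ − 1)/2` odd). Everything proved; no definition; nothing is closed by this file.
-/

set_option autoImplicit false
set_option linter.dupNamespace false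

namespace Summit.BirchSwinnertonDyer.BirchSwinnertonDyer.Theorems.ManinFrameResidueProperRTameTwist

section OrderCoprime

/-- **Half of `d′ − 1` is odd** for a prime `d′ ≠ 2` with `4 ∤ d′ − 1` (i.e. `d′ ≡ 3 (mod 4)`), and
`2 · ((d′ − 1)/2) = d′ − 1`. [folklore] -/
theorem half_sub_one_odd {d' : ℕ} (hd' : d'.Prime) (hd'2 : d' ≠ 2) (h4 : ¬ 4 ∣ d' - 1) :
    ¬ 2 ∣ (d' - 1) / 2 ∧ 2 * ((d' - 1) / 2) = d' - 1 := by
  have hodd : d' % 2 = 1 := (Nat.Prime.mod_two_eq_one_iff_ne_two hd').mpr hd'2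
  rcases Nat.odd_mod_four_iff.mp hodd with h1 | h3
  · exfalso; apply h4; have := Nat.div_add_mod d' 4; omega
  · have := Nat.div_add_mod d' 4; have := Nat.div_add_mod (d' - 1) 2; omega

/-- **`p` a square modulo an odd prime `d′ ≠ p` ⟹ `ord_{d′}(p) ∣ (d′ − 1)/2`** (Euler: `p^{(d′−1)/2} =
y^{d′−1} = 1`). [folklore] -/
theorem orderOf_dvd_half_of_isSquare {p d' : ℕ} (hp : p.Prime) (hd' : d'.Prime) (hd'2 : d' ≠ 2)
    (hpd' : p ≠ d') (hsq : IsSquare ((p : ZMod d'))) : orderOf ((p : ZMod d')) ∣ (d' - 1) / 2 := by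
  haveI : Fact d'.Prime := ⟨hd'⟩
  obtain ⟨y, hy⟩ := hsq
  have hp0 : ((p : ZMod d')) ≠ 0 := by
    rw [Ne, ZMod.natCast_eq_zero_iff]
    exact fun h ↦ hpd' ((Nat.prime_dvd_prime_iff_eq hd' hp).mp h).symm
  have hy0 : y ≠ 0 := by rintro rfl; exact hp0 (by rw [hy, mul_zero])
  have h2 : 2 * ((d' - 1) / 2) = d' - 1 := by
    have hodd : d' % 2 = 1 := (Nat.Prime.mod_two_eq_one_iff_ne_two hd').mpr hd'2
    have := Nat.div_add_mod (d' - 1) 2; omega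
  refine orderOf_dvd_of_pow_eq_one ?_
  rw [hy, ← sq, ← pow_mul, h2]
  exact ZMod.pow_card_sub_one_eq_one hy0

/-- **The order of `p` modulo the auxiliary prime is prime to `p − 1`.** For primes `p` and `d′ ≠ 2, p` with
`4 ∤ d′ − 1`, no odd prime `r ∣ p − 1` dividing `d′ − 1`, and `p` a square modulo `d′`:
`gcd(ord_{d′}(p), p − 1) = 1`. (Odd part: `ord ∣ d′ − 1`; `2`-part: `ord ∣ (d′ − 1)/2`, which is odd.) This is
the degree-of-the-completion hypothesis of the Literature fact
`kato_neron_isIntegral_twistedSymbolSum_of_additive_five_le` at `m = d′`. [folklore] -/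
theorem coprime_orderOf_sub_one {p d' : ℕ} (hp : p.Prime) (hd' : d'.Prime) (hd'2 : d' ≠ 2)
    (hpd' : p ≠ d') (h4 : ¬ 4 ∣ d' - 1)
    (hr : ∀ r : ℕ, r.Prime → r ≠ 2 → r ∣ p - 1 → ¬ r ∣ d' - 1)
    (hsq : IsSquare ((p : ZMod d'))) : Nat.Coprime (orderOf ((p : ZMod d'))) (p - 1) := by
  have hdvd : orderOf ((p : ZMod d')) ∣ (d' - 1) / 2 := orderOf_dvd_half_of_isSquare hp hd' hd'2 hpd' hsq
  obtain ⟨hodd, h2⟩ := half_sub_one_odd hd' hd'2 h4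
  refine Nat.coprime_of_dvd fun q hq hqo hqp ↦ ?_
  have hqhalf : q ∣ (d' - 1) / 2 := hqo.trans hdvd
  by_cases hq2 : q = 2
  · subst hq2; exact hodd hqhalf
  · exact hr q hq hq2 hqp (hqhalf.trans ⟨2, by omega⟩)

end OrderCoprime

end Summit.BirchSwinnertonDyer.BirchSwinnertonDyer.Theorems.ManinFrameResidueProperRTameTwist
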